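import Summits.Ventures.HSemireg.WedgeHankelKernelColumnSpace
import Summits.Ventures.HSemireg.WedgeHankelSubstitutionDet
import Summits.Ventures.HSemireg.WedgeHankelConfluentRank

/-!
# Venture HSemireg — THE COLUMN SPACES OF THE NODE CLASSES ARE THE OSCULATING FLATS OF THE RATIONAL NORMAL CURVE: a substitution `g` with `det g ≠ 0` moves column spaces by its moment
# matrix, **`col H_k(sbSeq g N q) = S_k(g) · col H_k(q)`** (H7's `H_k(g·q) = S_k(g) H_k(q) S_{N−k}(g)ᵀ` with an invertible right factor); a class of exact order `P + 1` at `0` has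
# **`col H_k(q) = span{e_0, …, e_m}`**, `m = min(P, k)` (`k + P ≤ N`); hence the node of order `P + 1` at `λ` has **`col H_k(exp(λΘ)·q) = span{(C(a,t) λ^{a−t})_a : t ≤ m}`** — the
# osculating `m`-flat at the Veronese point `ν_k(λ)` — and the node at `∞` has `col H_k(rev_N q) = span{e_k, …, e_{k−m}}`; with M14 the node kernels at one node form a flag

HONEST FRAMING. Part of the Lean index of the computation cell `pub-hsemireg` (seat p10 gen 25, Sunday typer «UNIFORM-IN-n»).
Finite-dimensional EXTERIOR ALGEBRA over a field + ranks / column spaces of Hankel matrices ONLY: no variety, no cohomology theory, no sheaf, no Ext group, no semiregularity map;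
nothing here says that HC / HC_CM / HC_AV holds; no Literature fact is declared or used.  Custodian versions as in `WedgeHankelSiegelIdeal` (1/3) and `WedgeHankelFrameChange`; the
dictionary (`expMul λ q` = the node class `exp(λΘ)·q(Θ)` of order `P+1`; `rev_N` = the node at `∞`; `S_c(g)` the moment matrix; `ν_k(λ) = (λ^a)_a`, its osculating vectors
`o_t(λ) = (C(a,t) λ^{a−t})_a = ∂_λ^t ν_k(λ)/t!`) is QUOTED, never asserted.

WHAT IS IN THE TREE.  M14 (`WedgeHankelKernelColumnSpace`): the kernel is an antitone function of `col H_k(q) ⊆ K^{k+1}`; H7 (`WedgeHankelSubstitutionCatalecticant`) `hankel1_sbSeq_eq_mul`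
(`H_k(sbSeq g N q) = S_k(g) · H_k(q) · S_{N−k}(g)ᵀ`), `sbSeq_shear` (`sbSeq(1 λ 0 1) = expMul λ`), `sbSeq_swap` (`sbSeq(0 1 1 0) = rev`); I1 (`WedgeHankelSubstitutionDet`) `det_sbMat`
(`det S_c(g) = (det g)^{c(c+1)/2}`), `sbMat_shear_apply` (the Pascal matrix); E6 (`WedgeHankelConfluentRank`) `rank_hankel1_of_order` (`= min(P,k) + 1`); E3/E5/E4 name the node KERNELS
(`SI_k ⊔ xRich(k,P)`, `SI_k ⊔ Φs λ xRich(k,P)`, `SI_k ⊔ yRich(k,P)`).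
THIS FILE names the node COLUMN SPACES (namespace `Summit.Ventures.HSemireg.Wedge.HankelOuter` continued; imports M14, I1 (with H7), E6):
* §436 SUBSTITUTIONS ACT ON COLUMN SPACES: `isUnit_sbMat_of_det_ne_zero` (every degree, `c = 0` included), `range_mulVecLin_transpose_sbMat_eq_top`,
  **`range_hankel1_mulVecLin_sbSeq`** (`det g ≠ 0`, `k ≤ N`: `col H_k(sbSeq g N q) = (col H_k(q)).map S_k(g)`), `hankel1_expMul_eq_hankel1_sbSeq` / **`range_hankel1_mulVecLin_expMul`**
  (`col H_k(expMul λ q) = (col H_k(q)).map S_k(shear λ)`), `hankel1_rev_eq_hankel1_sbSeq` / `range_hankel1_mulVecLin_rev` (`col H_k(rev_N q) = (col H_k(q)).map S_k(swap)`).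
* §437 THE NODE AT `0`: `mem_span_single_of_forall_eq_zero` (a vector supported on `[0, m]` lies in `span{e_0, …, e_m}`), **`range_hankel1_mulVecLin_of_order`** (`k + P ≤ N`, `q` of exact
  order `P + 1`: `col H_k(q) = span{e_0, …, e_{min(P,k)}}`).
* §438 THE NODE AT `λ` AND AT `∞`: `sbMat_shear_mulVec_single` (`S_k(shear λ) e_t = o_t(λ)`), **`range_hankel1_mulVecLin_expMul_of_order`** (THE OSCULATING FLAT
  `col H_k(expMul λ q) = span{o_t(λ) : t ≤ min(P,k)}`), `sbMat_swap_mulVec_single` (`S_k(swap) e_t = e_{k−t}`), **`range_hankel1_mulVecLin_rev_of_order`**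
  (`col H_k(rev_N q) = span{e_{k−t} : t ≤ min(P,k)}`).
* §439 READING with M14: **`Kr_w_expMul_mono_of_order_le`** (`P′ ≤ P`, same node `λ`, `k + P ≤ N`: `Kr(univ, w_N(expMul λ q), k) ≤ Kr(univ, w_N(expMul λ q′), k)` — the node kernels at
  one node form a FLAG indexed by the order, read off the nested osculating flats), `Kr_w_eq_of_order_eq'` (same node, same exact order ⇒ same kernel; E5 by value, here by `col`).
NOT typed here: sums of nodes (the confluent Vandermonde: osculating flats at distinct nodes are independent while the total order is `≤ N + 1 − k`; F2a's rank law is that statement);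
anything Ext-side.  New names only.
-/

open Module
open scoped Matrix

namespace Summit.Ventures.HSemireg.Wedge.HankelOuter

open Summit.Ventures.HSemireg.Wedge Summit.Ventures.HSemireg.Wedge.Kunneth Summit.Ventures.HSemireg.Wedge.Hankel
  Summit.Ventures.HSemireg.Wedge.BasisFree Summit.Ventures.HSemireg.Wedge.HankelSiegel Summit.Ventures.HSemireg.Wedge.HankelSiegelIdeal
  Summit.Ventures.HSemireg.Wedge.KunnethKernel Summit.Ventures.HSemireg.Wedge.HankelFrameChange Summit.Ventures.HSemireg.Wedge.KernelDuality

variable (K : Type*) [Field K] {N : ℕ}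

/-! ## §436. Substitutions act on column spaces through their moment matrices -/

/-- the moment matrix of a substitution with `det g ≠ 0` is invertible in EVERY degree (`det S_c(g) = (det g)^{c(c+1)/2}`, I1; `c = 0` included). -/
theorem isUnit_sbMat_of_det_ne_zero {c d : ℕ} (hd : d = c + 1) {α β γ δ : K} (hdet : α * δ - β * γ ≠ 0) : IsUnit (sbMat K α β γ δ c d) := by
  subst hd
  rw [Matrix.isUnit_iff_isUnit_det, det_sbMat]
  exact (pow_ne_zero _ hdet).isUnit

/-- … so `S_c(g)ᵀ` is onto. -/
theorem range_mulVecLin_transpose_sbMat_eq_top {c d : ℕ} (hd : d = c + 1) {α β γ δ : K} (hdet : α * δ - β * γ ≠ 0) :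
    LinearMap.range ((sbMat K α β γ δ c d)ᵀ).mulVecLin = ⊤ := by
  refine LinearMap.range_eq_top.mpr ?_
  rw [Matrix.coe_mulVecLin]
  exact Matrix.mulVec_surjective_iff_isUnit.mpr ((Matrix.isUnit_transpose _).mpr (isUnit_sbMat_of_det_ne_zero K hd hdet))

/-- **SUBSTITUTIONS MOVE COLUMN SPACES BY THE MOMENT MATRIX: `col H_k(sbSeq g N q) = S_k(g) · col H_k(q)`** for `det g ≠ 0`, `k ≤ N` (H7: `H_k(g·q) = S_k(g) H_k(q) S_{N−k}(g)ᵀ` and the right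
factor is onto). -/
theorem range_hankel1_mulVecLin_sbSeq {k : ℕ} (hk : k ≤ N) {α β γ δ : K} (hdet : α * δ - β * γ ≠ 0) (q : ℕ → K) :
    LinearMap.range (hankel1 K N k (sbSeq K α β γ δ N q)).mulVecLin = (LinearMap.range (hankel1 K N k q).mulVecLin).map (sbMat K α β γ δ k (k + 1)).mulVecLin := by
  rw [hankel1_sbSeq_eq_mul K hk, Matrix.mulVecLin_mul, Matrix.mulVecLin_mul,
    LinearMap.range_comp_of_range_eq_top _ (range_mulVecLin_transpose_sbMat_eq_top K (by omega) hdet), LinearMap.range_comp]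

/-- the catalecticant of a node class is that of the sheared sequence: `H_k(expMul λ q) = H_k(sbSeq (1 λ 0 1) N q)` (`k ≤ N`; `sbSeq_shear` on the window `[0, N]`). -/
theorem hankel1_expMul_eq_hankel1_sbSeq {k : ℕ} (hk : k ≤ N) (lam : K) (q : ℕ → K) :
    hankel1 K N k (expMul K lam q) = hankel1 K N k (sbSeq K 1 lam 0 1 N q) := by
  ext i s
  have hs := s.2
  simp only [hankel1, Matrix.of_apply]
  rw [sbSeq_shear K lam N q (by omega)]

/-- **`col H_k(exp(λΘ)·q) = S_k(shear λ) · col H_k(q)`** (`k ≤ N`): the shear moves column spaces by the Pascal matrix. -/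
theorem range_hankel1_mulVecLin_expMul {k : ℕ} (hk : k ≤ N) (lam : K) (q : ℕ → K) :
    LinearMap.range (hankel1 K N k (expMul K lam q)).mulVecLin = (LinearMap.range (hankel1 K N k q).mulVecLin).map (sbMat K 1 lam 0 1 k (k + 1)).mulVecLin := by
  rw [hankel1_expMul_eq_hankel1_sbSeq K hk, range_hankel1_mulVecLin_sbSeq K hk (by rw [mul_one, mul_zero, sub_zero]; exact one_ne_zero)]

/-- the catalecticant of the reversed class: `H_k(rev_N q) = H_k(sbSeq (0 1 1 0) N q)` (`sbSeq_swap`). -/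
theorem hankel1_rev_eq_hankel1_sbSeq (k : ℕ) (q : ℕ → K) :
    hankel1 K N k (rev K N q) = hankel1 K N k (sbSeq K 0 1 1 0 N q) := by
  ext i s
  simp only [hankel1, Matrix.of_apply]
  rw [sbSeq_swap]

/-- **`col H_k(rev_N q) = S_k(swap) · col H_k(q)`** (`k ≤ N`): the swap moves column spaces by the anti-diagonal moment matrix. -/
theorem range_hankel1_mulVecLin_rev {k : ℕ} (hk : k ≤ N) (q : ℕ → K) :
    LinearMap.range (hankel1 K N k (rev K N q)).mulVecLin = (LinearMap.range (hankel1 K N k q).mulVecLin).map (sbMat K 0 1 1 0 k (k + 1)).mulVecLin := by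
  rw [hankel1_rev_eq_hankel1_sbSeq, range_hankel1_mulVecLin_sbSeq K hk (by rw [zero_mul, one_mul, zero_sub]; exact neg_ne_zero.mpr one_ne_zero)]

/-! ## §437. The node at `0`: the column space of a class of exact order `P + 1` -/

/-- a vector of `K^{k+1}` supported on the coordinates `≤ m` lies in `span{e_0, …, e_m}` (`m ≤ k`). -/
theorem mem_span_single_of_forall_eq_zero {k m : ℕ} (hm : m ≤ k) {v : Fin (k + 1) → K} (hv : ∀ a : Fin (k + 1), m < (a : ℕ) → v a = 0) :
    v ∈ Submodule.span K (Set.range fun t : Fin (m + 1) => (Pi.single (Fin.castLE (by omega) t) (1 : K) : Fin (k + 1) → K)) := by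
  rw [pi_eq_sum_univ' v]
  refine Submodule.sum_mem _ fun a _ => ?_
  by_cases ha : (a : ℕ) ≤ m
  · exact Submodule.smul_mem _ _ (Submodule.subset_span ⟨⟨(a : ℕ), by omega⟩, by simp only [Fin.castLE_mk, Fin.eta]⟩)
  · rw [hv a (by omega), zero_smul]
    exact Submodule.zero_mem _

/-- **THE NODE AT `0`: a class of exact order `P + 1` at `0` (`q` supported on `[0, P]`, `q_P ≠ 0`, `k + P ≤ N`) has `col H_k(q) = span{e_0, …, e_m}`, `m = min(P, k)`** — every column
`(q_{a+s})_a` is supported on `a ≤ P`, and the rank is `m + 1` (E6). -/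
theorem range_hankel1_mulVecLin_of_order {k P : ℕ} (hkP : k + P ≤ N) {q : ℕ → K} (hq : ∀ j, P < j → q j = 0) (hqP : q P ≠ 0) :
    LinearMap.range (hankel1 K N k q).mulVecLin
      = Submodule.span K (Set.range fun t : Fin (min P k + 1) => (Pi.single (Fin.castLE (by omega) t) (1 : K) : Fin (k + 1) → K)) := by
  refine Submodule.eq_of_le_of_finrank_le ?_ ?_
  · rw [Matrix.range_mulVecLin, Submodule.span_le]
    rintro _ ⟨s, rfl⟩
    refine mem_span_single_of_forall_eq_zero K (Nat.min_le_right P k) fun a ha => ?_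
    rw [Matrix.col_apply]
    simp only [hankel1, Matrix.of_apply]
    exact hq _ (by have := a.2; omega)
  · have h := finrank_range_le_card (R := K) (fun t : Fin (min P k + 1) => (Pi.single (Fin.castLE (show min P k + 1 ≤ k + 1 by omega) t) (1 : K) : Fin (k + 1) → K))
    rw [Fintype.card_fin] at h
    refine h.trans (le_of_eq ?_)
    rw [← Matrix.rank, rank_hankel1_of_order K hkP hq hqP]

/-! ## §438. The node at `λ`: the osculating flat; the node at `∞` -/

/-- **`S_k(shear λ) e_t = o_t(λ) = (C(a,t) λ^{a−t})_a`**: the columns of the Pascal matrix are the osculating vectors of the rational normal curve at `ν_k(λ)` (`o_0 = ν_k(λ)` itself). -/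
theorem sbMat_shear_mulVec_single (lam : K) (k : ℕ) (t : Fin (k + 1)) :
    (sbMat K 1 lam 0 1 k (k + 1)).mulVecLin (Pi.single t (1 : K)) = fun a : Fin (k + 1) => ((((a : ℕ).choose (t : ℕ) : ℕ)) : K) * lam ^ ((a : ℕ) - (t : ℕ)) := by
  rw [Matrix.mulVecLin_apply, Matrix.mulVec_single_one]
  funext a
  rw [Matrix.col_apply, sbMat_shear_apply]
  by_cases h : (t : ℕ) ≤ a
  · rw [if_pos h]
  · rw [if_neg h, Nat.choose_eq_zero_of_lt (by omega), Nat.cast_zero, zero_mul]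

/-- **THE OSCULATING FLAT: the node class `exp(λΘ)·q` of exact order `P + 1` at `λ` (`k + P ≤ N`) has `col H_k(expMul λ q) = span{o_t(λ) : t ≤ min(P,k)}`,
`o_t(λ) = (C(a,t) λ^{a−t})_a`** — the osculating `min(P,k)`-flat of the rational normal curve at the Veronese point `ν_k(λ) = o_0(λ)` (shear of §437). -/
theorem range_hankel1_mulVecLin_expMul_of_order (lam : K) {k P : ℕ} (hkP : k + P ≤ N) {q : ℕ → K} (hq : ∀ j, P < j → q j = 0) (hqP : q P ≠ 0) :
    LinearMap.range (hankel1 K N k (expMul K lam q)).mulVecLin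
      = Submodule.span K (Set.range fun t : Fin (min P k + 1) => fun a : Fin (k + 1) => ((((a : ℕ).choose (t : ℕ) : ℕ)) : K) * lam ^ ((a : ℕ) - (t : ℕ))) := by
  rw [range_hankel1_mulVecLin_expMul K (by omega) lam q, range_hankel1_mulVecLin_of_order K hkP hq hqP, Submodule.map_span, ← Set.range_comp]
  refine congrArg _ (congrArg _ (funext fun t => ?_))
  rw [Function.comp_apply, sbMat_shear_mulVec_single]
  simp only [Fin.val_castLE]

/-- `S_k(swap) e_t = e_{k−t}`: the moment matrix of the swap is the anti-diagonal permutation matrix. -/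
theorem sbMat_swap_mulVec_single (k : ℕ) (t : Fin (k + 1)) :
    (sbMat K 0 1 1 0 k (k + 1)).mulVecLin (Pi.single t (1 : K)) = Pi.single (⟨k - (t : ℕ), by omega⟩ : Fin (k + 1)) (1 : K) := by
  rw [Matrix.mulVecLin_apply, Matrix.mulVec_single_one]
  funext a
  rw [Matrix.col_apply, sbMat_apply, sbSeq_swap, rev_apply_of_le K (show (a : ℕ) ≤ k by have := a.2; omega), Pi.single_apply]
  by_cases h : k - (a : ℕ) = (t : ℕ)
  · rw [if_pos h, if_pos (Fin.ext (by simp only; omega))]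
  · rw [if_neg h, if_neg (fun e => h (by rw [Fin.ext_iff] at e; simp only at e; omega))]

/-- **THE NODE AT `∞`: the reversed class `rev_N q` of a class of exact order `P + 1` (`k + P ≤ N`) has `col H_k(rev_N q) = span{e_{k−t} : t ≤ min(P,k)}`** — the osculating flat at
`ν_k(∞) = e_k`. -/
theorem range_hankel1_mulVecLin_rev_of_order {k P : ℕ} (hkP : k + P ≤ N) {q : ℕ → K} (hq : ∀ j, P < j → q j = 0) (hqP : q P ≠ 0) :
    LinearMap.range (hankel1 K N k (rev K N q)).mulVecLin
      = Submodule.span K (Set.range fun t : Fin (min P k + 1) => (Pi.single (⟨k - (t : ℕ), by omega⟩ : Fin (k + 1)) (1 : K) : Fin (k + 1) → K)) := by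
  rw [range_hankel1_mulVecLin_rev K (by omega) q, range_hankel1_mulVecLin_of_order K hkP hq hqP, Submodule.map_span, ← Set.range_comp]
  refine congrArg _ (congrArg _ (funext fun t => ?_))
  rw [Function.comp_apply, sbMat_swap_mulVec_single]
  exact congrArg (fun x : Fin (k + 1) => (Pi.single x (1 : K) : Fin (k + 1) → K)) (Fin.ext (by simp only [Fin.val_castLE]))

/-! ## §439. Reading with M14: at one node the kernels form a flag indexed by the order -/

/-- the osculating flats at one node are NESTED: `min(P′,k) ≤ min(P,k) ⇒ span{o_t(λ) : t ≤ min(P′,k)} ⊆ span{o_t(λ) : t ≤ min(P,k)}`. -/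
theorem span_osculating_mono (lam : K) {k m m' : ℕ} (hm : m' ≤ m) (hmk : m ≤ k) :
    Submodule.span K (Set.range fun t : Fin (m' + 1) => fun a : Fin (k + 1) => ((((a : ℕ).choose (t : ℕ) : ℕ)) : K) * lam ^ ((a : ℕ) - (t : ℕ)))
      ≤ Submodule.span K (Set.range fun t : Fin (m + 1) => fun a : Fin (k + 1) => ((((a : ℕ).choose (t : ℕ) : ℕ)) : K) * lam ^ ((a : ℕ) - (t : ℕ))) := by
  have _ := hmk
  refine Submodule.span_mono ?_
  rintro _ ⟨t, rfl⟩
  exact ⟨⟨(t : ℕ), by omega⟩, rfl⟩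

/-- **THE NODE KERNELS AT ONE NODE FORM A FLAG: for two classes of exact orders `P′ + 1 ≤ P + 1` at the same node `λ` (`k + P ≤ N`),
`Kr(univ, w_N(expMul λ q), k) ⊆ Kr(univ, w_N(expMul λ q′), k)`** — the higher-order node has the larger osculating flat, hence (M14) the smaller kernel. -/
theorem Kr_w_expMul_mono_of_order_le (lam : K) {k P P' : ℕ} (hP : P' ≤ P) (hkP : k + P ≤ N) {q q' : ℕ → K} (hq : ∀ j, P < j → q j = 0) (hqP : q P ≠ 0)
    (hq' : ∀ j, P' < j → q' j = 0) (hqP' : q' P' ≠ 0) :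
    Kr K (Finset.univ : Finset (In N)) (w K N N (expMul K lam q)) k ≤ Kr K (Finset.univ : Finset (In N)) (w K N N (expMul K lam q')) k := by
  refine Kr_w_anti_of_range_hankel1_le K k ?_
  rw [range_hankel1_mulVecLin_expMul_of_order K lam (by omega : k + P' ≤ N) hq' hqP', range_hankel1_mulVecLin_expMul_of_order K lam hkP hq hqP]
  exact span_osculating_mono K lam (min_le_min_right k hP) (Nat.min_le_right P k)

/-- same node, same exact order ⇒ same kernel (`k + P ≤ N`; E5's `SI_k ⊔ Φs λ xRich(k,P)` by value — here: equal osculating flats, M14). -/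
theorem Kr_w_eq_of_order_eq' (lam : K) {k P : ℕ} (hkP : k + P ≤ N) {q q' : ℕ → K} (hq : ∀ j, P < j → q j = 0) (hqP : q P ≠ 0)
    (hq' : ∀ j, P < j → q' j = 0) (hqP' : q' P ≠ 0) :
    Kr K (Finset.univ : Finset (In N)) (w K N N (expMul K lam q)) k = Kr K (Finset.univ : Finset (In N)) (w K N N (expMul K lam q')) k :=
  le_antisymm (Kr_w_expMul_mono_of_order_le K lam le_rfl hkP hq hqP hq' hqP') (Kr_w_expMul_mono_of_order_le K lam le_rfl hkP hq' hqP' hq hqP)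

end Summit.Ventures.HSemireg.Wedge.HankelOuter
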